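import Summits.FinalStateConjecture.FinalStateConjecture.Theorems.StarvedNecksNecksCertifyStubKirchhoffFormula
import Summits.FinalStateConjecture.FinalStateConjecture.Theorems.StarvedNecksNecksCertifyStubSphericalMeansCalculus
import Summits.FinalStateConjecture.FinalStateConjecture.Theorems.StarvedNecksNecksCertifyStubSphereMeanDarboux

/-!
# Route StarvedNecks — crux `NecksCertify`, line `two-cap-focusing-ledger`: strong Huygens principle

Registered helper sub-goal `stub_neckLedgerAnalysis_strongHuygens` of the physics stub
`stub_neckLedgerAnalysis` (model toolkit: data-borne radiation leaves the neck): the **strong Huygens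
principle / domain of dependence on `ℝ¹⁺³`** (Evans, *PDE*, §2.4.1(c), §2.4.3), read off the LANDED
Kirchhoff–Duhamel representation (`Kirchhoff.stub_kirchhoffFormula`, rung R1b, composed with the landed
rungs R1a-ii `SphericalMeans.stub_sphericalMeansCalculus` and R1a-i `Darboux.stub_sphereMeanDarboux`
into the unconditional formula, inlined in the proof).

For a smooth `ψ : E4 → ℝ`: if the Cauchy data `(ψ, ∂₀ψ)(t₀, ·)` vanish on an OPEN set `U ⊇` the sphere
of radius `t − t₀ > 0` about `x`, and `□_η ψ` vanishes on the backward characteristic cone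
`{(t − s, y) : ‖y − x‖ = s, 0 ≤ s ≤ t − t₀}`, then `ψ(t, x) = 0`.  Proof: Kirchhoff at the apex
`(t, x)` with radius `σ = t − t₀`; the far-sphere term vanishes (data on the sphere `⊆ U`), the
one-more-derivative term vanishes (`∂₀ψ = 0` by hypothesis and the spatial derivative of the slice
`y ↦ ψ(t₀, y)`, which vanishes identically on the open `U`, is zero there), and the Duhamel term
vanishes (`□_ηψ = 0` on the cone).

Two classical corollaries for data supported in a closed ball `closedBall x₀ R` at time `t₀` and
`□_ηψ = 0` on the slab `{t₀ ≤ y⁰ ≤ t}`: the **interior lacuna** (`t − t₀ > ‖x − x₀‖ + R ⇒ ψ(t,x) = 0`,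
sharp Huygens) and **finite speed of propagation** (`‖x − x₀‖ > R + (t − t₀) ⇒ ψ(t,x) = 0`), both by
taking `U = (closedBall x₀ R)ᶜ` and the triangle inequality.  Mathlib and the three landed R1 modules
only; no definitions, no named facts.
-/

noncomputable section

open scoped Manifold ContDiff Topology ENNReal
open Filter Set MeasureTheory Topology Literature.Geometry.Lorentzian

-- the doubled `FinalStateConjecture.FinalStateConjecture` path component trips dupNamespace
set_option linter.dupNamespace false

namespace Summit.FinalStateConjecture.FinalStateConjecture.Theorems.NecksCertifyTwoCap.Propagation

/-! ### Two pointwise facts -/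

/-- The point `x + s w` of the dilated unit sphere is at distance `s ≥ 0` from the centre `x`. -/
theorem norm_add_smul_sub_self (x : E3) {s : ℝ} (hs : 0 ≤ s) (w : Metric.sphere (0 : E3) 1) :
    ‖x + s • (w : E3) - x‖ = s := by
  rw [add_sub_cancel_left, norm_smul, norm_eq_of_mem_sphere, mul_one, Real.norm_of_nonneg hs]

/-- If the slice `y ↦ ψ(t₀, y)` of a differentiable `ψ` vanishes on an open set `U`, then every
spatial derivative `Dψ(t₀, y)(0, v)` vanishes at the points `y ∈ U` (chain rule through the affine
slice map `y ↦ (t₀, y)`, whose differential is `E4.spaceEmbed : v ↦ (0, v)`). -/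
theorem fderiv_space_eq_zero_of_slice_vanishes {ψ : E4 → ℝ} (hψ : Differentiable ℝ ψ)
    {U : Set E3} (hU : IsOpen U) (t₀ : ℝ) (h0 : ∀ y ∈ U, ψ (E4.ofTimeSpace t₀ y) = 0)
    {y : E3} (hy : y ∈ U) (v : E3) :
    fderiv ℝ ψ (E4.ofTimeSpace t₀ y) (E4.ofTimeSpace 0 v) = 0 := by
  have hg : HasFDerivAt (fun z ↦ ψ (E4.ofTimeSpace t₀ z))
      ((fderiv ℝ ψ (E4.ofTimeSpace t₀ y)).comp E4.spaceEmbed) y :=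
    (hψ _).hasFDerivAt.comp y (SphericalMeans.hasFDerivAt_ofTimeSpace_space t₀ y)
  have hev : (fun z ↦ ψ (E4.ofTimeSpace t₀ z)) =ᶠ[𝓝 y] fun _ ↦ (0 : ℝ) :=
    eventually_of_mem (hU.mem_nhds hy) fun z hz ↦ h0 z hz
  have hzero : fderiv ℝ (fun z ↦ ψ (E4.ofTimeSpace t₀ z)) y = 0 := by
    rw [hev.fderiv_eq, fderiv_const_apply]
  have h := congrArg (fun L : E3 →L[ℝ] ℝ ↦ L v) (hg.fderiv.symm.trans hzero)
  simpa using h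

/-! ### The registered helper: strong Huygens / domain of dependence -/

/-- Registered helper sub-goal `stub_neckLedgerAnalysis_strongHuygens` of line
`two-cap-focusing-ledger` (crux `StarvedNecks.NecksCertify`): the **strong Huygens principle on
`ℝ¹⁺³`** (Evans, *PDE*, §2.4.1(c), §2.4.3).  For smooth `ψ`, if `(ψ, ∂₀ψ)(t₀, ·)` vanish on an open
`U ⊇ sphere x (t − t₀)` (`t₀ < t`) and `□_ηψ(t − s, y) = 0` whenever `‖y − x‖ = s ∈ [0, t − t₀]`, then
`ψ(t, x) = 0`: all three terms of Kirchhoff's formula at the apex `(t, x)` with radius `t − t₀` vanish. -/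
theorem stub_neckLedgerAnalysis_strongHuygens : ∀ (ψ : E4 → ℝ), ContDiff ℝ ∞ ψ → ∀ (t₀ t : ℝ) (x : E3) (U : Set E3), IsOpen U → t₀ < t → Metric.sphere x (t - t₀) ⊆ U → (∀ y ∈ U, ψ (E4.ofTimeSpace t₀ y) = 0 ∧ fderiv ℝ ψ (E4.ofTimeSpace t₀ y) (E4.basisVector 0) = 0) → (∀ (s : ℝ) (y : E3), 0 ≤ s → s ≤ t - t₀ → ‖y - x‖ = s → KerrSchild.waveOperator (fun _ ↦ Kerr.etaComp) ψ (E4.ofTimeSpace (t - s) y) = 0) → ψ (E4.ofTimeSpace t x) = 0 := by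
  intro ψ hψ t₀ t x U hU ht hsph hdata hcone
  have hσ : 0 < t - t₀ := sub_pos.mpr ht
  have hn : (∞ : WithTop ℕ∞) ≠ 0 := by exact_mod_cast WithTop.coe_ne_zero.2 (by decide)
  have hdiff : Differentiable ℝ ψ := hψ.differentiable hn
  -- the far sphere `x + (t - t₀) S²` lies in `U`
  have hmemU : ∀ w : Metric.sphere (0 : E3) 1, x + (t - t₀) • (w : E3) ∈ U := fun w ↦
    hsph (by rw [Metric.mem_sphere, dist_eq_norm, norm_add_smul_sub_self x hσ.le w])
  -- (1) the far-sphere term: the data vanish on the sphere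
  have I1 : ∫ (w : Metric.sphere (0 : E3) 1), ψ (E4.ofTimeSpace t₀ (x + (t - t₀) • (w : E3)))
      ∂((volume : Measure E3).toSphere) = 0 :=
    integral_eq_zero_of_ae (Eventually.of_forall fun w ↦ (hdata _ (hmemU w)).1)
  -- (2) the one-more-derivative term: `Dψ(1, w) = ∂₀ψ + Dψ(0, w)`, both zero on the sphere
  have hpt : ∀ w : Metric.sphere (0 : E3) 1,
      fderiv ℝ ψ (E4.ofTimeSpace t₀ (x + (t - t₀) • (w : E3))) (E4.ofTimeSpace 1 (w : E3)) = 0 := by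
    intro w
    rw [Kirchhoff.ofTimeSpace_one_eq, map_add, (hdata _ (hmemU w)).2, zero_add]
    exact fderiv_space_eq_zero_of_slice_vanishes hdiff hU t₀ (fun y hy ↦ (hdata y hy).1)
      (hmemU w) _
  have I2 : ∫ (w : Metric.sphere (0 : E3) 1),
      fderiv ℝ ψ (E4.ofTimeSpace t₀ (x + (t - t₀) • (w : E3))) (E4.ofTimeSpace 1 (w : E3))
      ∂((volume : Measure E3).toSphere) = 0 :=
    integral_eq_zero_of_ae (Eventually.of_forall hpt)
  -- (3) the Duhamel term: `□_ηψ = 0` on the backward cone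
  have hEq : EqOn (fun s : ℝ ↦ s * ((((volume : Measure E3).toSphere univ).toReal)⁻¹ *
      ∫ (w : Metric.sphere (0 : E3) 1),
        KerrSchild.waveOperator (fun _ ↦ Kerr.etaComp) ψ
          (E4.ofTimeSpace (t - s) (x + s • (w : E3))) ∂((volume : Measure E3).toSphere)))
      (fun _ ↦ 0) (uIcc 0 (t - t₀)) := by
    intro s hs
    rw [uIcc_of_le hσ.le] at hs
    have h0 : ∫ (w : Metric.sphere (0 : E3) 1),
        KerrSchild.waveOperator (fun _ ↦ Kerr.etaComp) ψ
          (E4.ofTimeSpace (t - s) (x + s • (w : E3))) ∂((volume : Measure E3).toSphere) = 0 :=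
      integral_eq_zero_of_ae (Eventually.of_forall fun w ↦
        hcone s _ hs.1 hs.2 (norm_add_smul_sub_self x hs.1 w))
    simp only [h0, mul_zero]
  have I3 : ∫ s in (0 : ℝ)..(t - t₀), s * ((((volume : Measure E3).toSphere univ).toReal)⁻¹ *
      ∫ (w : Metric.sphere (0 : E3) 1),
        KerrSchild.waveOperator (fun _ ↦ Kerr.etaComp) ψ
          (E4.ofTimeSpace (t - s) (x + s • (w : E3))) ∂((volume : Measure E3).toSphere)) = 0 := by
    rw [intervalIntegral.integral_congr hEq, intervalIntegral.integral_zero]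
  -- the unconditional Kirchhoff formula (landed chain Darboux → spherical-means calculus → Kirchhoff)
  -- at the apex `(t, x)` with radius `t - t₀`
  have hK := Kirchhoff.stub_kirchhoffFormula
    (SphericalMeans.stub_sphericalMeansCalculus Darboux.stub_sphereMeanDarboux) ψ hψ t x (t - t₀) hσ
  rw [sub_sub_cancel, I1, I2, I3] at hK
  simpa using hK

/-! ### Corollaries: data supported in a closed ball -/

/-- Domain of dependence for compactly supported data: if `(ψ, ∂₀ψ)(t₀, ·)` vanish outside the closed
ball `closedBall x₀ R`, `□_ηψ = 0` on the slab `{t₀ ≤ y⁰ ≤ t}` (`t₀ < t`), and the sphere of radius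
`t − t₀` about `x` misses the closed ball, then `ψ(t, x) = 0` (the registered theorem with
`U = {y | R < ‖y − x₀‖}`). -/
theorem eq_zero_of_sphere_misses_ball {ψ : E4 → ℝ} (hψ : ContDiff ℝ ∞ ψ) {t₀ t : ℝ} (ht : t₀ < t)
    {x₀ : E3} {R : ℝ}
    (hdata : ∀ y, R < ‖y - x₀‖ → ψ (E4.ofTimeSpace t₀ y) = 0 ∧
      fderiv ℝ ψ (E4.ofTimeSpace t₀ y) (E4.basisVector 0) = 0)
    (hwave : ∀ (s : ℝ) (y : E3), t₀ ≤ s → s ≤ t →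
      KerrSchild.waveOperator (fun _ ↦ Kerr.etaComp) ψ (E4.ofTimeSpace s y) = 0)
    {x : E3} (hfar : ∀ y, ‖y - x‖ = t - t₀ → R < ‖y - x₀‖) :
    ψ (E4.ofTimeSpace t x) = 0 := by
  have hU : IsOpen {y : E3 | R < ‖y - x₀‖} :=
    isOpen_lt continuous_const (continuous_id.sub continuous_const).norm
  refine stub_neckLedgerAnalysis_strongHuygens ψ hψ t₀ t x {y : E3 | R < ‖y - x₀‖} hU ht
    (fun y hy ↦ hfar y ?_) (fun y hy ↦ hdata y hy) (fun s y hs0 hs1 _ ↦ hwave _ _ ?_ ?_)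
  · rwa [Metric.mem_sphere, dist_eq_norm] at hy
  · linarith
  · linarith

/-- **Interior lacuna (strong Huygens principle on `ℝ¹⁺³`)** (Evans, *PDE*, §2.4.3): if the data
`(ψ, ∂₀ψ)(t₀, ·)` vanish outside `closedBall x₀ R`, `□_ηψ = 0` on the slab `{t₀ ≤ y⁰ ≤ t}`, and
`t − t₀ > ‖x − x₀‖ + R` (the point `(t, x)` lies inside the inner light cone of the data ball), then
`ψ(t, x) = 0` — in three space dimensions signals propagate exactly at unit speed. -/
theorem strongHuygens_lacuna {ψ : E4 → ℝ} (hψ : ContDiff ℝ ∞ ψ) {t₀ t : ℝ} (ht : t₀ ≤ t)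
    {x₀ : E3} {R : ℝ}
    (hdata : ∀ y, R < ‖y - x₀‖ → ψ (E4.ofTimeSpace t₀ y) = 0 ∧
      fderiv ℝ ψ (E4.ofTimeSpace t₀ y) (E4.basisVector 0) = 0)
    (hwave : ∀ (s : ℝ) (y : E3), t₀ ≤ s → s ≤ t →
      KerrSchild.waveOperator (fun _ ↦ Kerr.etaComp) ψ (E4.ofTimeSpace s y) = 0)
    {x : E3} (hx : ‖x - x₀‖ + R < t - t₀) : ψ (E4.ofTimeSpace t x) = 0 := by
  rcases ht.eq_or_lt with rfl | ht'
  · have hR : R < ‖x - x₀‖ := by linarith [norm_nonneg (x - x₀)]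
    exact (hdata x hR).1
  · refine eq_zero_of_sphere_misses_ball hψ ht' hdata hwave fun y hy ↦ ?_
    have h1 : ‖y - x‖ ≤ ‖y - x₀‖ + ‖x₀ - x‖ := norm_sub_le_norm_sub_add_norm_sub y x₀ x
    rw [norm_sub_rev x₀ x, hy] at h1
    linarith

/-- **Finite speed of propagation on `ℝ¹⁺³`** (Evans, *PDE*, §2.4.3): if the data `(ψ, ∂₀ψ)(t₀, ·)`
vanish outside `closedBall x₀ R`, `□_ηψ = 0` on the slab `{t₀ ≤ y⁰ ≤ t}`, and
`‖x − x₀‖ > R + (t − t₀)` (the point `(t, x)` lies outside the outer light cone of the data ball), then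
`ψ(t, x) = 0`. -/
theorem finiteSpeed_exterior {ψ : E4 → ℝ} (hψ : ContDiff ℝ ∞ ψ) {t₀ t : ℝ} (ht : t₀ ≤ t)
    {x₀ : E3} {R : ℝ}
    (hdata : ∀ y, R < ‖y - x₀‖ → ψ (E4.ofTimeSpace t₀ y) = 0 ∧
      fderiv ℝ ψ (E4.ofTimeSpace t₀ y) (E4.basisVector 0) = 0)
    (hwave : ∀ (s : ℝ) (y : E3), t₀ ≤ s → s ≤ t →
      KerrSchild.waveOperator (fun _ ↦ Kerr.etaComp) ψ (E4.ofTimeSpace s y) = 0)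
    {x : E3} (hx : R + (t - t₀) < ‖x - x₀‖) : ψ (E4.ofTimeSpace t x) = 0 := by
  rcases ht.eq_or_lt with rfl | ht'
  · have hR : R < ‖x - x₀‖ := by linarith
    exact (hdata x hR).1
  · refine eq_zero_of_sphere_misses_ball hψ ht' hdata hwave fun y hy ↦ ?_
    have h1 : ‖x - x₀‖ ≤ ‖x - y‖ + ‖y - x₀‖ := norm_sub_le_norm_sub_add_norm_sub x y x₀
    rw [norm_sub_rev x y, hy] at h1
    linarith

end Summit.FinalStateConjecture.FinalStateConjecture.Theorems.NecksCertifyTwoCap.Propagation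

end
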